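import Literature.MathematicalPhysics.QuantumLattice.HubbardUVSymbolSurfaceDifferences
import HarnessLib

/-!
# The ultraviolet symbol at TWO band values / along TWO `C²` paths: every time difference and the first two space differences of
# `Ψ₁(ω, e₁) − Ψ₁(ω, e₂)` are LINEAR in the distance of the bands (`ε₀ = sup|p₁ − p₂|`, `ε₁ = sup|p₁′ − p₂′|`, `ε₂ = sup|p₁″ − p₂″|`)

Topic `MathematicalPhysics/QuantumLattice`; the two-frame companion of `HubbardUVSymbolSurfaceDifferences` (cell gate-hubbard-kl).  There the
normalised symbol `Ψ₁ = w_Λ·(−iω+e)⁻¹` of the covariance ABOVE scale `Λ` was composed with ONE dispersion relation along a lattice line/surface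
and differenced (time order `a`, space orders `≤ 2`).  A comparison of the one-shot covariances of the SAME scale in two FRAMES `K, K′`
(`e_K = ξ − K`, `e_{K′} = ξ − K′`; the flow frames of two volumes, or two consecutive flow frames) reads the DIFFERENCE symbol
`Ψ₁(ω, e_K(k)) − Ψ₁(ω, e_{K′}(k))`; its decay on the space–time grid (row/column sums of `Sᵀ(C^K_{>Λ} − C^{K′}_{>Λ})S` by weighted Plancherel, as
in `HubbardUVCovarianceCTDecayBound`) needs the same differences of the DIFFERENCE, and they are linear in the `C²` distance of the two bands
along the line: with the all-order mixed partials `Φ_{a,m} = ∂_e^m ∂_ω^a Ψ₁` and their envelopes `C_{a,m}(Λ)/max(|ω|,Λ/2)^{a+m+1}`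
(`HubbardUVSymbolMixedSmooth.norm_uvMixedFn_le`, every `a, m`):

* §1 `norm_uvMixedFn_sub_snd_le` — `‖Φ_{a,m}(ω,e₁) − Φ_{a,m}(ω,e₂)‖ ≤ C_{a,m+1}/max(|ω|,Λ/2)^{a+m+2}·|e₁ − e₂|` (mean value in `e`);
* §2 `norm_fwdDiff_iter_uvSymbolOneFn_sub_le` — TIME differences of every order `a` at two fixed band values:
  `‖Δ_{h₀}^a [Ψ₁(·,e₁) − Ψ₁(·,e₂)](ω₀)‖ ≤ h₀^a·C_{a,1}·|e₁ − e₂|/max(|ω₀| − a h₀, Λ/2)^{a+2}` (iterated mean value in `ω`);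
* §3 two `C²` paths `p₁, p₂` in the band variable (`|pᵢ′|, |pᵢ″| ≤ D`, `|p₁ − p₂| ≤ ε₀`, `|p₁′ − p₂′| ≤ ε₁`, `|p₁″ − p₂″| ≤ ε₂` everywhere):
  `norm_uvMixedFn_path_sub_le` (values), `hasDerivAt_uvMixedFn_path`, `norm_deriv_uvMixedFn_path_sub_le` (first derivative of the difference,
  `≤ (C_{a,2}(2/Λ)Dε₀ + C_{a,1}ε₁)/m^{a+2}`), `hasDerivAt_deriv_uvMixedFn_path`, `norm_deriv_two_uvMixedFn_path_sub_le` (second derivative,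
  `≤ (C_{a,3}(2/Λ)²D²ε₀ + C_{a,2}(2/Λ)(Dε₀ + 2Dε₁) + C_{a,1}ε₂)/m^{a+2}`), and the differences **`norm_fwdDiff_uvMixedFn_path_sub_le`**,
  **`norm_fwdDiff_two_uvMixedFn_path_sub_le`** (`h`, `h²` times those, mean value once/twice) — time order `a` arbitrary, at a fixed frequency.

For the flow frames of the KL programme the band distance is `εⱼ ≤ coeffNorm j (K ⊖ K′)` (`…VolumeLimitFlowFramesJets.norm_iteratedDeriv_eval_sub_line_le_coeffNorm`),
`O_j(1)/L` across two volumes.  Everything is proved; no definitions; no named facts.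

## Sources

G. Benfatto, A. Giuliani, V. Mastropietro, Ann. Henri Poincaré 7 (2006) 809–898, §2.2 (2.23) (flowing dispersion `E_{h−1} = E_h + …`),
(2.36aa), Lemma 2.2 (`BenfattoGiulianiMastropietro2006`); M. Salmhofer, *Renormalization* (1999), §4.2.5 (4.70)–(4.71) (`Salmhofer1999`).
The `[cite: …]` tags LOCATE the constructs; the statements are routine instances.
-/

noncomputable section

namespace Literature.MathematicalPhysics.QuantumLattice

open Literature.Probability.LatticeModels Set Complex Filter
open scoped _root_.Topology

variable {Λ : ℝ}

/-! ### §1 The mixed partials are Lipschitz in the band variable -/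

/-- `1/max(|ω|,Λ/2) ≤ 2/Λ`. [cite: Salmhofer1999, §4.2.5 (4.71)] -/
theorem inv_uvEnv_le (hΛ : 0 < Λ) (ω : ℝ) : 1 / max |ω| (Λ / 2) ≤ 2 / Λ := by
  have hm : 0 < max |ω| (Λ / 2) := uvEnv_pos hΛ ω
  rw [div_le_div_iff₀ hm hΛ, one_mul]
  linarith [le_max_right |ω| (Λ / 2)]

/-- **`‖Φ_{a,m}(ω,e₁) − Φ_{a,m}(ω,e₂)‖ ≤ C_{a,m+1}(Λ)/max(|ω|,Λ/2)^{a+m+2}·|e₁ − e₂|`** (mean value in the band variable: `∂_e Φ_{a,m} = Φ_{a,m+1}`,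
envelope uniform in `e`). [cite: BenfattoGiulianiMastropietro2006, (2.36aa)] -/
theorem norm_uvMixedFn_sub_snd_le (hΛ : 0 < Λ) (a m : ℕ) (ω e₁ e₂ : ℝ) :
    ‖uvMixedFn Λ a m (ω, e₁) - uvMixedFn Λ a m (ω, e₂)‖ ≤ uvMixedConst Λ a (m + 1) / max |ω| (Λ / 2) ^ (a + m + 2) * |e₁ - e₂| := by
  have h := Convex.norm_image_sub_le_of_norm_hasDerivWithin_le (f := fun e' => uvMixedFn Λ a m (ω, e'))
    (f' := fun e' => uvMixedFn Λ a (m + 1) (ω, e')) (s := Set.univ) (fun x _ => (hasDerivAt_uvMixedFn_snd hΛ a m ω x).hasDerivWithinAt)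
    (fun x _ => norm_uvMixedFn_le hΛ a (m + 1) ω x) convex_univ (Set.mem_univ e₂) (Set.mem_univ e₁)
  rw [Real.norm_eq_abs] at h
  simpa [add_assoc] using h

/-! ### §2 Time differences of every order at two band values -/

/-- **`‖Δ_{h₀}^a [Ψ₁(·,e₁) − Ψ₁(·,e₂)](ω₀)‖ ≤ h₀^a · (C_{a,1}(Λ)·|e₁ − e₂| / max(|ω₀| − a h₀, Λ/2)^{a+2})`** for every time order `a`, step `h₀ ≥ 0`
(the chain `ω ↦ Φ_{k,0}(ω,e₁) − Φ_{k,0}(ω,e₂)`, `k ≤ a`, iterated mean value; §1 at `m = 0` on `[ω₀, ω₀ + a h₀]`, where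
`max(|ω|,Λ/2) ≥ max(|ω₀| − a h₀, Λ/2)`). [cite: BenfattoGiulianiMastropietro2006, Lemma 2.2 and (2.36aa)] -/
theorem norm_fwdDiff_iter_uvSymbolOneFn_sub_le (hΛ : 0 < Λ) (a : ℕ) {h₀ : ℝ} (hh₀ : 0 ≤ h₀) (ω₀ e₁ e₂ : ℝ) :
    ‖(fwdDiff h₀)^[a] (fun ω => uvSymbolOneFn Λ (ω, e₁) - uvSymbolOneFn Λ (ω, e₂)) ω₀‖ ≤
      h₀ ^ a * (uvMixedConst Λ a 1 * |e₁ - e₂| / max (|ω₀| - a * h₀) (Λ / 2) ^ (a + 2)) := by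
  set g : ℕ → ℝ → ℂ := fun k ω => uvMixedFn Λ k 0 (ω, e₁) - uvMixedFn Λ k 0 (ω, e₂) with hg
  have hg0 : (fun ω => uvSymbolOneFn Λ (ω, e₁) - uvSymbolOneFn Λ (ω, e₂)) = g 0 := by
    simp only [hg, uvMixedFn_zero_zero]
  have hder : ∀ (k : ℕ) (ω : ℝ), HasDerivAt (g k) (g (k + 1) ω) ω := fun k ω =>
    (hasDerivAt_uvMixedFn_fst hΛ k ω e₁).sub (hasDerivAt_uvMixedFn_fst hΛ k ω e₂)
  set mS := max (|ω₀| - a * h₀) (Λ / 2) with hmS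
  have hmS0 : 0 < mS := lt_max_of_lt_right (by positivity)
  have hC := uvMixedConst_nonneg Λ a 1
  have hB : ∀ ω ∈ Icc ω₀ (ω₀ + a * h₀), ‖g a ω‖ ≤ uvMixedConst Λ a 1 * |e₁ - e₂| / mS ^ (a + 2) := by
    intro ω hω
    have h1 := norm_uvMixedFn_sub_snd_le hΛ a 0 ω e₁ e₂
    have hmt : mS ≤ max |ω| (Λ / 2) := by
      refine max_le_max ?_ le_rfl
      have h1 : |ω₀| ≤ |ω| + |ω₀ - ω| := by
        have := abs_add_le ω (ω₀ - ω); rwa [add_sub_cancel] at this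
      have h2 : |ω₀ - ω| ≤ a * h₀ := by
        rw [abs_sub_comm, abs_of_nonneg (by linarith [hω.1])]; linarith [hω.2]
      linarith
    have hpow : mS ^ (a + 2) ≤ max |ω| (Λ / 2) ^ (a + 2) := pow_le_pow_left₀ hmS0.le hmt _
    calc ‖g a ω‖ ≤ uvMixedConst Λ a (0 + 1) / max |ω| (Λ / 2) ^ (a + 0 + 2) * |e₁ - e₂| := h1
      _ = uvMixedConst Λ a 1 * |e₁ - e₂| / max |ω| (Λ / 2) ^ (a + 2) := by simp [div_mul_eq_mul_div]
      _ ≤ uvMixedConst Λ a 1 * |e₁ - e₂| / mS ^ (a + 2) :=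
          div_le_div_of_nonneg_left (by positivity) (pow_pos hmS0 _) hpow
  rw [hg0]
  exact Literature.Analysis.norm_fwdDiff_iter_le_of_hasDerivAt (E := ℂ) hh₀ a g ω₀ _ (fun k _ ω _ => hder k ω) hB

/-! ### §3 Two `C²` paths in the band variable: values, first and second derivatives/differences of the difference -/

section Paths

variable {D ε₀ ε₁ ε₂ : ℝ} {p₁ p₂ p₁' p₂' p₁'' p₂'' : ℝ → ℝ}

/-- **Values**: `‖Φ_{a,0}(ω,p₁(t)) − Φ_{a,0}(ω,p₂(t))‖ ≤ C_{a,1}·ε₀/max(|ω|,Λ/2)^{a+2}` if `|p₁ − p₂| ≤ ε₀`.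
[cite: BenfattoGiulianiMastropietro2006, (2.36aa)] -/
theorem norm_uvMixedFn_path_sub_le (hΛ : 0 < Λ) (h₀ : ∀ t, |p₁ t - p₂ t| ≤ ε₀) (a : ℕ) (ω t : ℝ) :
    ‖uvMixedFn Λ a 0 (ω, p₁ t) - uvMixedFn Λ a 0 (ω, p₂ t)‖ ≤ uvMixedConst Λ a 1 * ε₀ / max |ω| (Λ / 2) ^ (a + 2) := by
  have hC := uvMixedConst_nonneg Λ a 1
  have hm : 0 < max |ω| (Λ / 2) := uvEnv_pos hΛ ω
  calc ‖uvMixedFn Λ a 0 (ω, p₁ t) - uvMixedFn Λ a 0 (ω, p₂ t)‖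
      ≤ uvMixedConst Λ a (0 + 1) / max |ω| (Λ / 2) ^ (a + 0 + 2) * |p₁ t - p₂ t| := norm_uvMixedFn_sub_snd_le hΛ a 0 ω _ _
    _ ≤ uvMixedConst Λ a 1 / max |ω| (Λ / 2) ^ (a + 2) * ε₀ := by
        simpa using mul_le_mul_of_nonneg_left (h₀ t) (by positivity : 0 ≤ uvMixedConst Λ a 1 / max |ω| (Λ / 2) ^ (a + 2))
    _ = uvMixedConst Λ a 1 * ε₀ / max |ω| (Λ / 2) ^ (a + 2) := by ring

/-- **Chain rule along a path**: `t ↦ Φ_{a,m}(ω, p(t))` has derivative `p′(t)·Φ_{a,m+1}(ω,p(t))`. [cite: BenfattoGiulianiMastropietro2006, (2.36aa)] -/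
theorem hasDerivAt_uvMixedFn_path (hΛ : 0 < Λ) {p p' : ℝ → ℝ} (hp : ∀ t, HasDerivAt p (p' t) t) (a m : ℕ) (ω t : ℝ) :
    HasDerivAt (fun t' => uvMixedFn Λ a m (ω, p t')) (((p' t : ℝ) : ℂ) * uvMixedFn Λ a (m + 1) (ω, p t)) t := by
  have h := (hasDerivAt_uvMixedFn_snd hΛ a m ω (p t)).scomp t (hp t)
  simpa [Complex.real_smul, Function.comp_def] using h

/-- **The derivative of `t ↦ p′(t)·Φ_{a,m+1}(ω,p(t))`** is `p″Φ_{a,m+1}(p) + p′²Φ_{a,m+2}(p)`. [cite: BenfattoGiulianiMastropietro2006, (2.36aa)] -/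
theorem hasDerivAt_deriv_uvMixedFn_path (hΛ : 0 < Λ) {p p' p'' : ℝ → ℝ} (hp : ∀ t, HasDerivAt p (p' t) t) (hp' : ∀ t, HasDerivAt p' (p'' t) t)
    (a m : ℕ) (ω t : ℝ) :
    HasDerivAt (fun t' => ((p' t' : ℝ) : ℂ) * uvMixedFn Λ a (m + 1) (ω, p t'))
      (((p'' t : ℝ) : ℂ) * uvMixedFn Λ a (m + 1) (ω, p t) + ((p' t : ℝ) : ℂ) * (((p' t : ℝ) : ℂ) * uvMixedFn Λ a (m + 2) (ω, p t))) t := by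
  have h1 : HasDerivAt (fun t' => ((p' t' : ℝ) : ℂ)) ((p'' t : ℝ) : ℂ) t := (hp' t).ofReal_comp
  have h2 := hasDerivAt_uvMixedFn_path hΛ hp a (m + 1) ω t
  exact h1.mul h2

/-- **First derivative of the difference along two paths**: with `|pᵢ′| ≤ D`, `|p₁ − p₂| ≤ ε₀`, `|p₁′ − p₂′| ≤ ε₁`,
`‖p₁′Φ_{a,1}(p₁) − p₂′Φ_{a,1}(p₂)‖ ≤ (C_{a,2}·(2/Λ)·D·ε₀ + C_{a,1}·ε₁)/max(|ω|,Λ/2)^{a+2}`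
(`= p₁′(Φ₁(p₁) − Φ₁(p₂)) + (p₁′ − p₂′)Φ₁(p₂)`; one envelope traded for `2/Λ`). [cite: BenfattoGiulianiMastropietro2006, (2.36aa)] -/
theorem norm_deriv_uvMixedFn_path_sub_le (hΛ : 0 < Λ) (hD : 0 ≤ D) (hε₀ : 0 ≤ ε₀)
    (bp₁ : ∀ t, |p₁' t| ≤ D) (h₀ : ∀ t, |p₁ t - p₂ t| ≤ ε₀) (h₁ : ∀ t, |p₁' t - p₂' t| ≤ ε₁) (a : ℕ) (ω t : ℝ) :
    ‖((p₁' t : ℝ) : ℂ) * uvMixedFn Λ a 1 (ω, p₁ t) - ((p₂' t : ℝ) : ℂ) * uvMixedFn Λ a 1 (ω, p₂ t)‖ ≤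
      (uvMixedConst Λ a 2 * (2 / Λ) * D * ε₀ + uvMixedConst Λ a 1 * ε₁) / max |ω| (Λ / 2) ^ (a + 2) := by
  set m := max |ω| (Λ / 2) with hmdef
  have hm : 0 < m := uvEnv_pos hΛ ω
  have hC1 := uvMixedConst_nonneg Λ a 1
  have hC2 := uvMixedConst_nonneg Λ a 2
  have hε₁ : 0 ≤ ε₁ := (abs_nonneg _).trans (h₁ t)
  have hmΛ : 1 / m ≤ 2 / Λ := inv_uvEnv_le hΛ ω
  -- the split
  have hid : ((p₁' t : ℝ) : ℂ) * uvMixedFn Λ a 1 (ω, p₁ t) - ((p₂' t : ℝ) : ℂ) * uvMixedFn Λ a 1 (ω, p₂ t) =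
      ((p₁' t : ℝ) : ℂ) * (uvMixedFn Λ a 1 (ω, p₁ t) - uvMixedFn Λ a 1 (ω, p₂ t)) +
        (((p₁' t - p₂' t : ℝ) : ℂ)) * uvMixedFn Λ a 1 (ω, p₂ t) := by
    push_cast; ring
  rw [hid]
  have hA : ‖((p₁' t : ℝ) : ℂ) * (uvMixedFn Λ a 1 (ω, p₁ t) - uvMixedFn Λ a 1 (ω, p₂ t))‖ ≤ D * (uvMixedConst Λ a 2 / m ^ (a + 3) * ε₀) := by
    rw [norm_mul, Complex.norm_real, Real.norm_eq_abs]
    refine mul_le_mul (bp₁ t) ?_ (norm_nonneg _) hD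
    calc ‖uvMixedFn Λ a 1 (ω, p₁ t) - uvMixedFn Λ a 1 (ω, p₂ t)‖
        ≤ uvMixedConst Λ a (1 + 1) / m ^ (a + 1 + 2) * |p₁ t - p₂ t| := norm_uvMixedFn_sub_snd_le hΛ a 1 ω _ _
      _ ≤ uvMixedConst Λ a 2 / m ^ (a + 3) * ε₀ := by
          simpa [add_assoc] using mul_le_mul_of_nonneg_left (h₀ t) (by positivity : 0 ≤ uvMixedConst Λ a 2 / m ^ (a + 3))
  have hB : ‖(((p₁' t - p₂' t : ℝ) : ℂ)) * uvMixedFn Λ a 1 (ω, p₂ t)‖ ≤ ε₁ * (uvMixedConst Λ a 1 / m ^ (a + 2)) := by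
    rw [norm_mul, Complex.norm_real, Real.norm_eq_abs]
    exact mul_le_mul (h₁ t) (norm_uvMixedFn_le hΛ a 1 ω _) (norm_nonneg _) hε₁
  have hA' : D * (uvMixedConst Λ a 2 / m ^ (a + 3) * ε₀) ≤ uvMixedConst Λ a 2 * (2 / Λ) * D * ε₀ / m ^ (a + 2) := by
    rw [show D * (uvMixedConst Λ a 2 / m ^ (a + 3) * ε₀) = uvMixedConst Λ a 2 * (1 / m) * D * ε₀ / m ^ (a + 2) by
      field_simp; ring]
    exact div_le_div_of_nonneg_right (mul_le_mul_of_nonneg_right (mul_le_mul_of_nonneg_right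
      (mul_le_mul_of_nonneg_left hmΛ hC2) hD) hε₀) (by positivity)
  calc _ ≤ ‖((p₁' t : ℝ) : ℂ) * (uvMixedFn Λ a 1 (ω, p₁ t) - uvMixedFn Λ a 1 (ω, p₂ t))‖ +
        ‖(((p₁' t - p₂' t : ℝ) : ℂ)) * uvMixedFn Λ a 1 (ω, p₂ t)‖ := norm_add_le _ _
    _ ≤ uvMixedConst Λ a 2 * (2 / Λ) * D * ε₀ / m ^ (a + 2) + ε₁ * (uvMixedConst Λ a 1 / m ^ (a + 2)) := add_le_add (hA.trans hA') hB
    _ = _ := by ring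

/-- **Second derivative of the difference along two paths**: with `|pᵢ′|, |pᵢ″| ≤ D`, `|p₁ − p₂| ≤ ε₀`, `|p₁′ − p₂′| ≤ ε₁`, `|p₁″ − p₂″| ≤ ε₂`,
`‖(p₁″Φ₁(p₁) + p₁′²Φ₂(p₁)) − (p₂″Φ₁(p₂) + p₂′²Φ₂(p₂))‖ ≤ (C_{a,3}(2/Λ)²D²ε₀ + C_{a,2}(2/Λ)(Dε₀ + 2Dε₁) + C_{a,1}ε₂)/max(|ω|,Λ/2)^{a+2}`
(`p₁″(Φ₁(p₁)−Φ₁(p₂)) + (p₁″−p₂″)Φ₁(p₂) + p₁′²(Φ₂(p₁)−Φ₂(p₂)) + (p₁′−p₂′)(p₁′+p₂′)Φ₂(p₂)`). [cite: BenfattoGiulianiMastropietro2006, (2.36aa)] -/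
theorem norm_deriv_two_uvMixedFn_path_sub_le (hΛ : 0 < Λ) (hD : 0 ≤ D) (hε₀ : 0 ≤ ε₀) (hε₁ : 0 ≤ ε₁)
    (bp₁ : ∀ t, |p₁' t| ≤ D) (bp₂ : ∀ t, |p₂' t| ≤ D) (bq₁ : ∀ t, |p₁'' t| ≤ D)
    (h₀ : ∀ t, |p₁ t - p₂ t| ≤ ε₀) (h₁ : ∀ t, |p₁' t - p₂' t| ≤ ε₁) (h₂ : ∀ t, |p₁'' t - p₂'' t| ≤ ε₂) (a : ℕ) (ω t : ℝ) :
    ‖(((p₁'' t : ℝ) : ℂ) * uvMixedFn Λ a 1 (ω, p₁ t) + ((p₁' t : ℝ) : ℂ) * (((p₁' t : ℝ) : ℂ) * uvMixedFn Λ a 2 (ω, p₁ t))) -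
        (((p₂'' t : ℝ) : ℂ) * uvMixedFn Λ a 1 (ω, p₂ t) + ((p₂' t : ℝ) : ℂ) * (((p₂' t : ℝ) : ℂ) * uvMixedFn Λ a 2 (ω, p₂ t)))‖ ≤
      (uvMixedConst Λ a 3 * (2 / Λ) ^ 2 * D ^ 2 * ε₀ + uvMixedConst Λ a 2 * (2 / Λ) * (D * ε₀ + 2 * D * ε₁) + uvMixedConst Λ a 1 * ε₂) /
        max |ω| (Λ / 2) ^ (a + 2) := by
  set m := max |ω| (Λ / 2) with hmdef
  have hm : 0 < m := uvEnv_pos hΛ ω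
  have hC1 := uvMixedConst_nonneg Λ a 1
  have hC2 := uvMixedConst_nonneg Λ a 2
  have hC3 := uvMixedConst_nonneg Λ a 3
  have hε₂ : 0 ≤ ε₂ := (abs_nonneg _).trans (h₂ t)
  have hmΛ : 1 / m ≤ 2 / Λ := inv_uvEnv_le hΛ ω
  have hmΛ0 : 0 ≤ 1 / m := by positivity
  set Φ₁ := fun e => uvMixedFn Λ a 1 (ω, e) with hΦ₁
  set Φ₂ := fun e => uvMixedFn Λ a 2 (ω, e) with hΦ₂
  -- the four-term split
  have hid : (((p₁'' t : ℝ) : ℂ) * Φ₁ (p₁ t) + ((p₁' t : ℝ) : ℂ) * (((p₁' t : ℝ) : ℂ) * Φ₂ (p₁ t))) -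
      (((p₂'' t : ℝ) : ℂ) * Φ₁ (p₂ t) + ((p₂' t : ℝ) : ℂ) * (((p₂' t : ℝ) : ℂ) * Φ₂ (p₂ t))) =
      ((p₁'' t : ℝ) : ℂ) * (Φ₁ (p₁ t) - Φ₁ (p₂ t)) + (((p₁'' t - p₂'' t : ℝ)) : ℂ) * Φ₁ (p₂ t) +
        (((p₁' t : ℝ) : ℂ) * ((p₁' t : ℝ) : ℂ)) * (Φ₂ (p₁ t) - Φ₂ (p₂ t)) +
        ((((p₁' t - p₂' t) * (p₁' t + p₂' t) : ℝ)) : ℂ) * Φ₂ (p₂ t) := by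
    push_cast; ring
  rw [hid]
  -- the four bounds
  have hT1 : ‖((p₁'' t : ℝ) : ℂ) * (Φ₁ (p₁ t) - Φ₁ (p₂ t))‖ ≤ D * (uvMixedConst Λ a 2 / m ^ (a + 3) * ε₀) := by
    rw [norm_mul, Complex.norm_real, Real.norm_eq_abs]
    refine mul_le_mul (bq₁ t) ?_ (norm_nonneg _) hD
    calc ‖Φ₁ (p₁ t) - Φ₁ (p₂ t)‖ ≤ uvMixedConst Λ a (1 + 1) / m ^ (a + 1 + 2) * |p₁ t - p₂ t| := norm_uvMixedFn_sub_snd_le hΛ a 1 ω _ _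
      _ ≤ uvMixedConst Λ a 2 / m ^ (a + 3) * ε₀ := by
          simpa [add_assoc] using mul_le_mul_of_nonneg_left (h₀ t) (by positivity : 0 ≤ uvMixedConst Λ a 2 / m ^ (a + 3))
  have hT2 : ‖(((p₁'' t - p₂'' t : ℝ)) : ℂ) * Φ₁ (p₂ t)‖ ≤ ε₂ * (uvMixedConst Λ a 1 / m ^ (a + 2)) := by
    rw [norm_mul, Complex.norm_real, Real.norm_eq_abs]
    exact mul_le_mul (h₂ t) (norm_uvMixedFn_le hΛ a 1 ω _) (norm_nonneg _) hε₂
  have hT3 : ‖(((p₁' t : ℝ) : ℂ) * ((p₁' t : ℝ) : ℂ)) * (Φ₂ (p₁ t) - Φ₂ (p₂ t))‖ ≤ D ^ 2 * (uvMixedConst Λ a 3 / m ^ (a + 4) * ε₀) := by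
    rw [norm_mul, norm_mul, Complex.norm_real, Real.norm_eq_abs, ← sq]
    refine mul_le_mul (pow_le_pow_left₀ (abs_nonneg _) (bp₁ t) 2) ?_ (norm_nonneg _) (by positivity)
    calc ‖Φ₂ (p₁ t) - Φ₂ (p₂ t)‖ ≤ uvMixedConst Λ a (2 + 1) / m ^ (a + 2 + 2) * |p₁ t - p₂ t| := norm_uvMixedFn_sub_snd_le hΛ a 2 ω _ _
      _ ≤ uvMixedConst Λ a 3 / m ^ (a + 4) * ε₀ := by
          simpa [add_assoc] using mul_le_mul_of_nonneg_left (h₀ t) (by positivity : 0 ≤ uvMixedConst Λ a 3 / m ^ (a + 4))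
  have hT4 : ‖((((p₁' t - p₂' t) * (p₁' t + p₂' t) : ℝ)) : ℂ) * Φ₂ (p₂ t)‖ ≤ (ε₁ * (2 * D)) * (uvMixedConst Λ a 2 / m ^ (a + 3)) := by
    rw [norm_mul, Complex.norm_real, Real.norm_eq_abs, abs_mul]
    refine mul_le_mul (mul_le_mul (h₁ t) ?_ (abs_nonneg _) hε₁) (norm_uvMixedFn_le hΛ a 2 ω _) (norm_nonneg _) (by positivity)
    calc |p₁' t + p₂' t| ≤ |p₁' t| + |p₂' t| := abs_add_le _ _
      _ ≤ D + D := add_le_add (bp₁ t) (bp₂ t)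
      _ = 2 * D := by ring
  -- trading envelopes for `2/Λ`
  have hpow3 : (1 : ℝ) / m ^ (a + 3) = (1 / m) / m ^ (a + 2) := by field_simp; ring
  have hpow4 : (1 : ℝ) / m ^ (a + 4) = (1 / m) ^ 2 / m ^ (a + 2) := by field_simp; ring
  have hT1' : D * (uvMixedConst Λ a 2 / m ^ (a + 3) * ε₀) ≤ uvMixedConst Λ a 2 * (2 / Λ) * (D * ε₀) / m ^ (a + 2) := by
    rw [show D * (uvMixedConst Λ a 2 / m ^ (a + 3) * ε₀) = uvMixedConst Λ a 2 * (1 / m) * (D * ε₀) / m ^ (a + 2) by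
      field_simp; ring]
    exact div_le_div_of_nonneg_right (mul_le_mul_of_nonneg_right (mul_le_mul_of_nonneg_left hmΛ hC2) (by positivity)) (by positivity)
  have hT3' : D ^ 2 * (uvMixedConst Λ a 3 / m ^ (a + 4) * ε₀) ≤ uvMixedConst Λ a 3 * (2 / Λ) ^ 2 * D ^ 2 * ε₀ / m ^ (a + 2) := by
    rw [show D ^ 2 * (uvMixedConst Λ a 3 / m ^ (a + 4) * ε₀) = uvMixedConst Λ a 3 * (1 / m) ^ 2 * D ^ 2 * ε₀ / m ^ (a + 2) by
      field_simp; ring]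
    exact div_le_div_of_nonneg_right (mul_le_mul_of_nonneg_right (mul_le_mul_of_nonneg_right
      (mul_le_mul_of_nonneg_left (pow_le_pow_left₀ hmΛ0 hmΛ 2) hC3) (by positivity)) hε₀) (by positivity)
  have hT4' : (ε₁ * (2 * D)) * (uvMixedConst Λ a 2 / m ^ (a + 3)) ≤ uvMixedConst Λ a 2 * (2 / Λ) * (2 * D * ε₁) / m ^ (a + 2) := by
    rw [show (ε₁ * (2 * D)) * (uvMixedConst Λ a 2 / m ^ (a + 3)) = uvMixedConst Λ a 2 * (1 / m) * (2 * D * ε₁) / m ^ (a + 2) by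
      field_simp; ring]
    exact div_le_div_of_nonneg_right (mul_le_mul_of_nonneg_right (mul_le_mul_of_nonneg_left hmΛ hC2) (by positivity)) (by positivity)
  calc _ ≤ ‖((p₁'' t : ℝ) : ℂ) * (Φ₁ (p₁ t) - Φ₁ (p₂ t))‖ + ‖(((p₁'' t - p₂'' t : ℝ)) : ℂ) * Φ₁ (p₂ t)‖ +
        ‖(((p₁' t : ℝ) : ℂ) * ((p₁' t : ℝ) : ℂ)) * (Φ₂ (p₁ t) - Φ₂ (p₂ t))‖ +
        ‖((((p₁' t - p₂' t) * (p₁' t + p₂' t) : ℝ)) : ℂ) * Φ₂ (p₂ t)‖ := by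
          refine (norm_add_le _ _).trans (add_le_add ((norm_add_le _ _).trans (add_le_add (norm_add_le _ _) le_rfl)) le_rfl)
    _ ≤ uvMixedConst Λ a 2 * (2 / Λ) * (D * ε₀) / m ^ (a + 2) + ε₂ * (uvMixedConst Λ a 1 / m ^ (a + 2)) +
        uvMixedConst Λ a 3 * (2 / Λ) ^ 2 * D ^ 2 * ε₀ / m ^ (a + 2) + uvMixedConst Λ a 2 * (2 / Λ) * (2 * D * ε₁) / m ^ (a + 2) :=
          add_le_add (add_le_add (add_le_add (hT1.trans hT1') hT2) (hT3.trans hT3')) (hT4.trans hT4')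
    _ = _ := by ring

/-- **First DIFFERENCE of the difference along two paths**: `‖Δ_h[Φ_{a,0}(ω,p₁(·)) − Φ_{a,0}(ω,p₂(·))](x)‖ ≤ h·(C_{a,2}(2/Λ)Dε₀ + C_{a,1}ε₁)/max(|ω|,Λ/2)^{a+2}`
(`h ≥ 0`; mean value once). [cite: BenfattoGiulianiMastropietro2006, Lemma 2.2 and (2.36aa)] -/
theorem norm_fwdDiff_uvMixedFn_path_sub_le (hΛ : 0 < Λ) (hD : 0 ≤ D) (hε₀ : 0 ≤ ε₀)
    (hp₁ : ∀ t, HasDerivAt p₁ (p₁' t) t) (hp₂ : ∀ t, HasDerivAt p₂ (p₂' t) t)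
    (bp₁ : ∀ t, |p₁' t| ≤ D) (h₀ : ∀ t, |p₁ t - p₂ t| ≤ ε₀) (h₁ : ∀ t, |p₁' t - p₂' t| ≤ ε₁) (a : ℕ) {h : ℝ} (hh : 0 ≤ h) (ω x : ℝ) :
    ‖fwdDiff h (fun t => uvMixedFn Λ a 0 (ω, p₁ t) - uvMixedFn Λ a 0 (ω, p₂ t)) x‖ ≤
      h * ((uvMixedConst Λ a 2 * (2 / Λ) * D * ε₀ + uvMixedConst Λ a 1 * ε₁) / max |ω| (Λ / 2) ^ (a + 2)) := by
  have hder : ∀ t, HasDerivAt (fun t' => uvMixedFn Λ a 0 (ω, p₁ t') - uvMixedFn Λ a 0 (ω, p₂ t'))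
      (((p₁' t : ℝ) : ℂ) * uvMixedFn Λ a 1 (ω, p₁ t) - ((p₂' t : ℝ) : ℂ) * uvMixedFn Λ a 1 (ω, p₂ t)) t := fun t =>
    (hasDerivAt_uvMixedFn_path hΛ hp₁ a 0 ω t).sub (hasDerivAt_uvMixedFn_path hΛ hp₂ a 0 ω t)
  have hmain := Literature.Analysis.norm_sub_le_of_norm_deriv_le (f := fun t' => uvMixedFn Λ a 0 (ω, p₁ t') - uvMixedFn Λ a 0 (ω, p₂ t'))
    (x := x) hh (fun t _ => hder t) (fun t _ => norm_deriv_uvMixedFn_path_sub_le hΛ hD hε₀ bp₁ h₀ h₁ a ω t)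
  simpa [fwdDiff] using hmain

/-- **Second DIFFERENCE of the difference along two paths**:
`‖Δ_h²[Φ_{a,0}(ω,p₁(·)) − Φ_{a,0}(ω,p₂(·))](x)‖ ≤ h²·(C_{a,3}(2/Λ)²D²ε₀ + C_{a,2}(2/Λ)(Dε₀ + 2Dε₁) + C_{a,1}ε₂)/max(|ω|,Λ/2)^{a+2}`
(`h ≥ 0`; mean value twice, `norm_second_difference_le`). [cite: BenfattoGiulianiMastropietro2006, Lemma 2.2 and (2.36aa)] -/
theorem norm_fwdDiff_two_uvMixedFn_path_sub_le (hΛ : 0 < Λ) (hD : 0 ≤ D) (hε₀ : 0 ≤ ε₀) (hε₁ : 0 ≤ ε₁)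
    (hp₁ : ∀ t, HasDerivAt p₁ (p₁' t) t) (hp₂ : ∀ t, HasDerivAt p₂ (p₂' t) t)
    (hq₁ : ∀ t, HasDerivAt p₁' (p₁'' t) t) (hq₂ : ∀ t, HasDerivAt p₂' (p₂'' t) t)
    (bp₁ : ∀ t, |p₁' t| ≤ D) (bp₂ : ∀ t, |p₂' t| ≤ D) (bq₁ : ∀ t, |p₁'' t| ≤ D)
    (h₀ : ∀ t, |p₁ t - p₂ t| ≤ ε₀) (h₁ : ∀ t, |p₁' t - p₂' t| ≤ ε₁) (h₂ : ∀ t, |p₁'' t - p₂'' t| ≤ ε₂) (a : ℕ) {h : ℝ} (hh : 0 ≤ h)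
    (ω x : ℝ) :
    ‖(fun t => uvMixedFn Λ a 0 (ω, p₁ t) - uvMixedFn Λ a 0 (ω, p₂ t)) (x + 2 * h) -
        (2 : ℝ) • (fun t => uvMixedFn Λ a 0 (ω, p₁ t) - uvMixedFn Λ a 0 (ω, p₂ t)) (x + h) +
        (fun t => uvMixedFn Λ a 0 (ω, p₁ t) - uvMixedFn Λ a 0 (ω, p₂ t)) x‖ ≤
      h ^ 2 * ((uvMixedConst Λ a 3 * (2 / Λ) ^ 2 * D ^ 2 * ε₀ + uvMixedConst Λ a 2 * (2 / Λ) * (D * ε₀ + 2 * D * ε₁) + uvMixedConst Λ a 1 * ε₂) /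
        max |ω| (Λ / 2) ^ (a + 2)) := by
  have hder : ∀ t, HasDerivAt (fun t' => uvMixedFn Λ a 0 (ω, p₁ t') - uvMixedFn Λ a 0 (ω, p₂ t'))
      (((p₁' t : ℝ) : ℂ) * uvMixedFn Λ a 1 (ω, p₁ t) - ((p₂' t : ℝ) : ℂ) * uvMixedFn Λ a 1 (ω, p₂ t)) t := fun t =>
    (hasDerivAt_uvMixedFn_path hΛ hp₁ a 0 ω t).sub (hasDerivAt_uvMixedFn_path hΛ hp₂ a 0 ω t)
  have hder2 : ∀ t, HasDerivAt (fun t' => ((p₁' t' : ℝ) : ℂ) * uvMixedFn Λ a 1 (ω, p₁ t') - ((p₂' t' : ℝ) : ℂ) * uvMixedFn Λ a 1 (ω, p₂ t'))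
      ((((p₁'' t : ℝ) : ℂ) * uvMixedFn Λ a 1 (ω, p₁ t) + ((p₁' t : ℝ) : ℂ) * (((p₁' t : ℝ) : ℂ) * uvMixedFn Λ a 2 (ω, p₁ t))) -
        (((p₂'' t : ℝ) : ℂ) * uvMixedFn Λ a 1 (ω, p₂ t) + ((p₂' t : ℝ) : ℂ) * (((p₂' t : ℝ) : ℂ) * uvMixedFn Λ a 2 (ω, p₂ t)))) t :=
    fun t => (hasDerivAt_deriv_uvMixedFn_path hΛ hp₁ hq₁ a 0 ω t).sub (hasDerivAt_deriv_uvMixedFn_path hΛ hp₂ hq₂ a 0 ω t)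
  exact Literature.Analysis.norm_second_difference_le (f := fun t' => uvMixedFn Λ a 0 (ω, p₁ t') - uvMixedFn Λ a 0 (ω, p₂ t'))
    (x := x) hh (fun t _ => hder t) (fun t _ => hder2 t)
    (fun t _ => norm_deriv_two_uvMixedFn_path_sub_le hΛ hD hε₀ hε₁ bp₁ bp₂ bq₁ h₀ h₁ h₂ a ω t)

end Paths

end Literature.MathematicalPhysics.QuantumLattice

end
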